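import Summits.BirchSwinnertonDyer.BirchSwinnertonDyer.Theorems.ByReductionTypeAtTwoSelmerDualContraBridge
import Literature.NumberTheory.EllipticCurves.Kato2004.DivisibilityInputsContragredient
import Literature.NumberTheory.EllipticCurves.Kato2004.DivisibilityInputs
import HarnessLib

/-!
# The END re-keys: Kato's divisibilities from the PRINT-EXACT (contragredient) §17.13 packages —
# row-1′ (`kato_divisibility` from `exists_divisibilityInputs_contra`) and VII′
# (`katoDivisibility_{nonsplit,split}Mult_of_contra_facts` from `exists_multDivisibilityInputs_{nonsplit,split}_contra`)

Seat `bsd-2adic-tower-1` GEN 19 (cell `bsd-2adic`), idle-seat wake `plan/WAKE-IDLE-2ADIC-VIIprime-contra-rekey.md` (planner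
RC-206) and bsd-cited ARM-P RULINGS (658)(d) / (659)(b) («END road `kato_divisibility_of_inputs` → ι-SAFE-by-FE = twin +
T-TWIST-SEL-1 + K1 + K5»; «bsd-2adic VII′ → V′/VI′ + FE by name»). HONEST FRAMING: THEOREMS ONLY — no definition, no named
fact, no instance, no `sorry`; route-independent (no `Theses` import); closes no item; nothing booked; BSD is NOT proved by any
of this. The γ-typed siblings (`Kato2004.kato_divisibility_of_inputs`, `Kato2004.katoDivisibility_{nonsplit,split}Mult_of_facts`)
are untouched (D-0014) and keep their STRONGER-THAN-PRINT-BY-ι reading; this file gives the SAME conclusions from the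
print-exact twins of p604443. PLACEMENT: Summits `Theorems` (the twist lemma T-TWIST-SEL-1 and the bridges are Summits-side),
not the `Literature/…ContraProofs.lean` the wake suggested; no tree `Theorems` file consumed the siblings by name, so nothing
downstream moves.

## Structure

* §1 GOOD ORDINARY (row-1′). `katoBody_contra_of_inputs`: the PROVED module theory of §17.13
  (`Kato2004.exists_mem_charIdeal_of_skeleton` for clauses 1–2, `Kato2004.mem_charIdeal_of_skeleton_integral` for clause 3,
  `Kato2004.lengthAt_eq_zero_of_finite_of_C_not_mem` for (17.13.4)) run on a contragredient package
  `K : DivisibilityInputsContra W p f κ γ I D′` — the three clauses of `kato_divisibility` FOR `D′` (finiteness of `D′.X` a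
  hypothesis). **`kato_divisibility_of_contra_inputs : nonempty_iwasawaH1Data → thm12_4 → exists_divisibilityInputs_contra →
  kato_divisibility W p`** — the tree's named fact `Literature.NumberTheory.EllipticCurves.kato_divisibility` (ARM-P row 1)
  from the twin, by the bridge `SelmerDualContra.katoBody_of_contra` (T-TWIST-SEL-1 + FE `L_p(E,T^ι) ∈ Λ^× L_p(E,T)` by name).
* §2 MULTIPLICATIVE (VII′). `G_ne_zero_contra`; `katoDivisibility_{nonsplit,split}Mult_contra_of_inputs` (the module theory
  `exists_mem_charIdeal_of_skeleton_upTo` / `exists_X_mul_mem_charIdeal_of_skeleton_exceptional` on a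
  `MultDivisibilityInputsContra` package, for `D′`); **`katoDivisibility_nonsplitMult_of_contra_facts`** /
  **`katoDivisibility_splitMult_of_contra_facts`** — the conclusions of VII′ for the tree's `γ`-datum `D` from
  `nonempty_iwasawaH1Data`, `thm12_4` and V′ / VI′, by the bridges `multNonsplitBody_of_contra` / `multSplitBody_of_contra`
  (T-TWIST-SEL-1 + MTT §I.17 by name); signature delta w.r.t. VII′ (honest): the printed functional equation is stated at
  level `N = pM`, `p ∤ M`, so `(hNM) (hpM)` are carried as in the tree's FE theorems — discharged at the conductor level
  `N = N_W` by `…_conductorLevel` (PROVED `f_p = 1`).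

References: [Kato2004Asterisque, Thm. 12.4–12.6 (pp. 221–222), Thm. 17.4 (p. 273), §17.3 (p. 273), §17.13 (pp. 279–280)];
[MazurTateTeitelbaum1986Invent, §I.17]; [GreenbergLNM1716, §1 (pp. 67–68)]; [Greenberg1989, §0 pp. 101–102 (S^ι)];
[BurungaleSkinner2023, Prop. 2.2]; [Wuthrich2014, Cor. 19 (p. 398)]; [Kobayashi2006DocMath, Thm. 4.1]; [Rohrlich1984, (L_p ≠ 0)].
-/

set_option autoImplicit false
-- the Theorems namespace of this sub repeats the summit name by design (D-0017 nested layout)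
set_option linter.dupNamespace false

noncomputable section

open scoped Classical MatrixGroups ModularForm

namespace Summit.BirchSwinnertonDyer.BirchSwinnertonDyer.Theorems

namespace SelmerDualContra

open PowerSeries CongruenceSubgroup Field Literature.NumberTheory.EllipticCurves
  Literature.NumberTheory.EllipticCurves.Module Literature.NumberTheory.EllipticCurves.ModularForms
  Literature.NumberTheory.EllipticCurves.Kato2004

/-! ## §1 GOOD ORDINARY: `kato_divisibility` from the print-exact twin `exists_divisibilityInputs_contra` (row-1′) -/

section Ordinary

variable {W : WeierstrassCurve ℚ} [W.IsElliptic] [W.IsGloballyMinimal] {p : ℕ} [Fact p.Prime]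
  [ContinuousSMul ℤ_[p] (W.tateModule p)] {κ : ZpExtension ℚ p} {γ : absoluteGaloisGroup ℚ}
  {N : ℕ} [NeZero N] {f : CuspForm (Gamma0 N) 2}
  {I : IwasawaH1Data W p κ γ} {D' : W.SelmerDualData κ γ⁻¹}

/-- **The three clauses of `kato_divisibility` FOR THE CONTRAGREDIENT DATUM `D′` from a contragredient §17.13 package**
(the sibling `kato_divisibility_body_of_skeleton` is tied to a `γ`-datum through `SelmerDualData.module_finite_of_isCyclotomic`;
here finiteness of `D′.X` is a hypothesis, supplied by the twist in `kato_divisibility_of_contra_inputs`): `X` torsion and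
`ι g = p^n · L_p(E,T)` with `g ∈ char_Λ` (PROVED `exists_mem_charIdeal_of_skeleton`, (17.13.4) via
`lengthAt_eq_zero_of_finite_of_C_not_mem`), and under surjectivity `ι g = L_p(E,T)` with `g ∈ char_Λ` (PROVED
`mem_charIdeal_of_skeleton_integral` on the package's `integral` clause; `L_p ≠ 0` by `padicLFunction_unitRoot_ne_zero`).
[cite: Kato2004Asterisque, Thm. 17.4 (p. 273) and §17.13 (pp. 279–280)] -/
theorem katoBody_contra_of_inputs [Module.Finite (IwasawaAlgebra p) D'.X] (hord : IsOrdinaryAt W p)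
    (hf : IsNewformOf W f) (h12 : thm12_4) (hκ : κ.IsCyclotomic) (hγ : κ.IsTopGenerator γ)
    (K : DivisibilityInputsContra W p f κ γ I D') :
    D'.IsTorsion ∧
    (∃ (n : ℕ) (g : IwasawaAlgebra p), g ∈ D'.charIdeal ∧
      iwasawaToPowerSeries p g =
        PowerSeries.C ((p : ℚ_[p]) ^ n) * padicLFunction f (unitRoot W p : ℚ_[p])) ∧
    ((∀ n : ℕ, W.HasSurjectiveModNGaloisRep (p ^ n : ℕ)) →
      ∃ g ∈ D'.charIdeal, iwasawaToPowerSeries p g = padicLFunction f (unitRoot W p : ℚ_[p])) := by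
  obtain ⟨htf, hrank⟩ := h12.isTorsionFree_and_rank_le_one W p hκ hγ I
  haveI := htf
  haveI := K.finite_H2loc
  have hL := padicLFunction_unitRoot_ne_zero hord hf
  have hG : K.G ≠ 0 := by
    intro hG0
    have hpn : PowerSeries.C ((p : ℚ_[p]) ^ K.n) ≠ 0 := by
      rw [Ne, map_eq_zero_iff _ (PowerSeries.C_injective), pow_eq_zero_iff']
      exact fun h => (Nat.cast_ne_zero.mpr (Fact.out : p.Prime).ne_zero) h.1
    have h := K.ιG_eq
    rw [hG0, map_zero, eq_comm, mul_eq_zero] at h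
    exact h.elim hpn hL
  obtain ⟨htors, h2⟩ := exists_mem_charIdeal_of_skeleton p hrank K.loc K.toX K.δ K.exact_P K.exact_X
    K.col K.col_injective K.isTorsion_H2 K.Z hG K.pow_mem K.es_bound
    (fun 𝔭 _ hp𝔭 ↦ lengthAt_eq_zero_of_finite_of_C_not_mem K.H2loc 𝔭 hp𝔭) K.ιG_eq
  refine ⟨htors, h2, fun hsurj ↦ ?_⟩
  obtain ⟨Z', G', hGZ', hιG', hES'⟩ := K.integral hsurj
  have hG' : G' ≠ 0 := by
    intro hG0
    rw [hG0, map_zero] at hιG'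
    exact hL hιG'.symm
  exact ⟨G', (mem_charIdeal_of_skeleton_integral p hrank K.loc K.toX K.δ K.exact_P K.exact_X K.col
    K.col_injective K.isTorsion_H2 Z' hG' hGZ' hES').2, hιG'⟩

/-- **`kato_divisibility` from the PRINT-EXACT twin (row-1′).** The tree's named fact
`Literature.NumberTheory.EllipticCurves.kato_divisibility W p` (Kato Thm. 17.4 (1)–(3) for `T_pE`, file `PAdicBSD`; bsd-cited
ARM-P row 1) follows from `nonempty_iwasawaH1Data`, `thm12_4` and the CONTRAGREDIENT package fact
`exists_divisibilityInputs_contra` (p604443): for the given `γ`-datum `D`, every contragredient datum `D′` receives a package,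
the module theory gives the three clauses for `D′` (`katoBody_contra_of_inputs`), and the bridge
`SelmerDualContra.katoBody_of_contra` (T-TWIST-SEL-1 + the printed functional equation by name) moves them to `D`.
Same conclusion as the sibling `Kato2004.kato_divisibility_of_inputs` (which binds the γ-typed `exists_divisibilityInputs`).
[cite: Kato2004Asterisque, Thm. 17.4 (p. 273) and §17.13 (pp. 279–280)] [cite: MazurTateTeitelbaum1986Invent, §I.17]
[cite: Greenberg1989, §0 pp. 101–102 (S^ι)] -/
theorem kato_divisibility_of_contra_inputs (hne : nonempty_iwasawaH1Data) (h12 : thm12_4)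
    (hin : exists_divisibilityInputs_contra) :
    kato_divisibility W p (κ := κ) (γ := γ) (f := f) := by
  intro hp hord hκ hγ hγ' hf D
  refine katoBody_of_contra hord hf hκ hγ D (fun D' hfin ↦ ?_)
  haveI := hfin
  obtain ⟨I⟩ := hne W p κ γ hκ hγ
  obtain ⟨K⟩ := hin W p f κ γ hp hord hκ hγ hγ' hf I D'
  exact katoBody_contra_of_inputs hord hf h12 hκ hγ K

end Ordinary

/-! ## §2 MULTIPLICATIVE: VII′ re-keyed to the twins V′ / VI′ -/

section Mult

variable {W : WeierstrassCurve ℚ} [W.IsElliptic] {p : ℕ} [Fact p.Prime]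
  [ContinuousSMul ℤ_[p] (W.tateModule p)] {L : PowerSeries ℚ_[p]}
  {κ : ZpExtension ℚ p} {γ : absoluteGaloisGroup ℚ}
  {I : IwasawaH1Data W p κ γ} {D' : W.SelmerDualData κ γ⁻¹}

/-- `G ≠ 0` in a contragredient multiplicative package for a non-zero `L` (the sibling `MultDivisibilityInputs.G_ne_zero`
verbatim). [cite: Kato2004Asterisque, Thm. 16.2 (p. 269) (L ∈ Λ ⊗ ℚ)] -/
theorem G_ne_zero_contra (K : MultDivisibilityInputsContra W p L κ γ I D') (hL : L ≠ 0) : K.G ≠ 0 := by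
  intro hG0
  have hpn : PowerSeries.C ((p : ℚ_[p]) ^ K.n) ≠ 0 := by
    rw [Ne, map_eq_zero_iff _ (PowerSeries.C_injective), pow_eq_zero_iff']
    exact fun h => (Nat.cast_ne_zero.mpr (Fact.out : p.Prime).ne_zero) h.1
  have h := K.ιG_eq
  rw [hG0, map_zero, eq_comm, mul_eq_zero] at h
  exact h.elim hpn hL

/-- **Kato's `⊗ℚ` divisibility at a NON-SPLIT multiplicative prime FOR THE CONTRAGREDIENT DATUM `D′` from a contragredient
package** (the sibling `katoDivisibility_nonsplitMult_of_inputs` run on `MultDivisibilityInputsContra`; finiteness of `D′.X` a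
hypothesis). [cite: Kato2004Asterisque, Thm. 17.4 (1)(2) (p. 273; shape) and §17.13 (pp. 279–280)] -/
theorem katoDivisibility_nonsplitMult_contra_of_inputs [Module.Finite (IwasawaAlgebra p) D'.X] (h12 : thm12_4)
    (hκ : κ.IsCyclotomic) (hγ : κ.IsTopGenerator γ) (K : MultDivisibilityInputsContra W p L κ γ I D')
    (hH2loc : ∀ 𝔭 : PrimeSpectrum (IwasawaAlgebra p), 𝔭.asIdeal.height = 1 →
      PowerSeries.C (p : ℤ_[p]) ∉ 𝔭.asIdeal → lengthAt (IwasawaAlgebra p) K.H2loc 𝔭 = 0)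
    (hL : L ≠ 0) :
    D'.IsTorsion ∧
      ∃ (m : ℕ) (g : IwasawaAlgebra p), g ∈ D'.charIdeal ∧
        iwasawaToPowerSeries p g = PowerSeries.C ((p : ℚ_[p]) ^ m) * L := by
  obtain ⟨htf, hrank⟩ := h12.isTorsionFree_and_rank_le_one W p hκ hγ I
  haveI := htf
  obtain ⟨hc0, hc⟩ := natCast_pow_ne_zero_and_not_mem p K.a
  exact exists_mem_charIdeal_of_skeleton_upTo p hrank hc0 hc K.loc K.toX K.δ K.upTo_P K.upTo_X
    K.col K.col_injective K.isTorsion_H2 K.Z (G_ne_zero_contra K hL) K.pow_mem K.es_bound hH2loc K.ιG_eq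

/-- **Kato's `⊗ℚ` divisibility at a SPLIT multiplicative prime, exceptional zero divided out, FOR THE CONTRAGREDIENT DATUM
`D′` from a contragredient package** (the sibling `katoDivisibility_splitMult_of_inputs` run on
`MultDivisibilityInputsContra`). [cite: Kato2004Asterisque, Thm. 12.5 (3) (p. 222), §17.13 (pp. 279–280)]
[cite: Wuthrich2014, Cor. 19 (p. 398; shape, odd p)] -/
theorem katoDivisibility_splitMult_contra_of_inputs [Module.Finite (IwasawaAlgebra p) D'.X] (h12 : thm12_4)
    (hκ : κ.IsCyclotomic) (hγ : κ.IsTopGenerator γ) (K : MultDivisibilityInputsContra W p L κ γ I D')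
    (hcol : ∀ y : K.P, K.col y ∈ Ideal.span {(PowerSeries.X : IwasawaAlgebra p)})
    (hL : L ≠ 0) (hL0 : PowerSeries.constantCoeff L = 0) :
    D'.IsTorsion ∧
      ∃ (m : ℕ) (g : IwasawaAlgebra p), g ∈ D'.charIdeal ∧
        iwasawaToPowerSeries p (PowerSeries.X * g) = PowerSeries.C ((p : ℚ_[p]) ^ m) * L := by
  obtain ⟨htf, hrank⟩ := h12.isTorsionFree_and_rank_le_one W p hκ hγ I
  haveI := htf
  obtain ⟨hc0, hc⟩ := natCast_pow_ne_zero_and_not_mem p K.a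
  refine exists_X_mul_mem_charIdeal_of_skeleton_exceptional p hrank hc0 hc K.loc K.toX K.δ K.ε
    K.upTo_P K.upTo_X K.upTo_H2 K.upTo_H2loc K.col K.col_injective hcol K.isTorsion_H2 K.Z
    (G_ne_zero_contra K hL) K.pow_mem (fun 𝔭 h1 hp𝔭 => ?_) K.es_bound K.ιG_eq hL0
  exact ne_top_of_le_ne_top (by simp) (K.lengthAt_H2loc_le_one 𝔭 h1 hp𝔭)

/-- **VII′ NON-SPLIT, print-exact binders.** For `W` multiplicative NON-split at an odd `p`, `f` its newform of level
`N = pM` (`p ∤ M`), `L ≠ 0` THE Mazur–Tate–Teitelbaum function (`IsMultPAdicLFunctionOf f p (−1) L`) and every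
cyclotomic datum `D : W.SelmerDualData κ γ` (`γ` normalised): `X(E/ℚ_∞)` is `Λ`-torsion and `ι g = p^m · L` for some
`m` and some `g ∈ char_Λ X` — from `nonempty_iwasawaH1Data`, `thm12_4` and the CONTRAGREDIENT package V′
`exists_multDivisibilityInputs_nonsplit_contra`, by the bridge `multNonsplitBody_of_contra`. Same conclusion as
`Kato2004.katoDivisibility_nonsplitMult_of_facts` (VII′, γ-typed V).
[cite: Kato2004Asterisque, Thm. 17.4 (1)(2) (p. 273; shape) and §17.13 (pp. 279–280)]
[cite: MazurTateTeitelbaum1986Invent, §I.17] [cite: Greenberg1989, §0 pp. 101–102 (S^ι)] -/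
theorem katoDivisibility_nonsplitMult_of_contra_facts [W.IsGloballyMinimal] (hne : nonempty_iwasawaH1Data) (h12 : thm12_4)
    (hin : exists_multDivisibilityInputs_nonsplit_contra) (hp : p ≠ 2)
    (hmult : W.HasMultiplicativeReductionAtPrime p) (hns : ¬ W.HasSplitMultiplicativeReductionAtPrime p)
    (hκ : κ.IsCyclotomic) (hγ : κ.IsTopGenerator γ) (hγ' : IsCyclotomicVariable p γ) {N : ℕ} [NeZero N]
    {f : CuspForm (Gamma0 N) 2} (hf : IsNewformOf W f) {M : ℕ} (hNM : N = p * M) (hpM : ¬ p ∣ M)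
    (hLf : IsMultPAdicLFunctionOf f p (-1) L) (hL : L ≠ 0) (D : W.SelmerDualData κ γ) :
    D.IsTorsion ∧
      ∃ (m : ℕ) (g : IwasawaAlgebra p), g ∈ D.charIdeal ∧
        iwasawaToPowerSeries p g = PowerSeries.C ((p : ℚ_[p]) ^ m) * L := by
  refine multNonsplitBody_of_contra hf hmult hns hNM hpM hLf hκ hγ D (fun D' hfin ↦ ?_)
  haveI := hfin
  obtain ⟨I⟩ := hne W p κ γ hκ hγ
  obtain ⟨K, hK⟩ := hin W p f κ γ hp hmult hns hκ hγ hγ' hf L hLf I D'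
  exact katoDivisibility_nonsplitMult_contra_of_inputs h12 hκ hγ K hK hL

/-- **VII′ SPLIT, print-exact binders.** For `W` SPLIT multiplicative at an odd `p`, `f` its newform of level `N = pM`
(`p ∤ M`), `L ≠ 0` with `IsSplitMultPAdicLFunctionOf f p L` and every cyclotomic datum `D : W.SelmerDualData κ γ`: `X` is
`Λ`-torsion and `ι(T · g) = p^m · L` for some `m` and some `g ∈ char_Λ X` — from `nonempty_iwasawaH1Data`, `thm12_4` and
the CONTRAGREDIENT package VI′ `exists_multDivisibilityInputs_split_contra`, by the bridge `multSplitBody_of_contra`. Same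
conclusion as `Kato2004.katoDivisibility_splitMult_of_facts` (VII′, γ-typed VI).
[cite: Kato2004Asterisque, §17.13 (pp. 279–280)] [cite: Wuthrich2014, Cor. 19 (p. 398; shape, odd p)]
[cite: MazurTateTeitelbaum1986Invent, §I.17] [cite: Greenberg1989, §0 pp. 101–102 (S^ι)] -/
theorem katoDivisibility_splitMult_of_contra_facts [W.IsGloballyMinimal] (hne : nonempty_iwasawaH1Data) (h12 : thm12_4)
    (hin : exists_multDivisibilityInputs_split_contra) (hp : p ≠ 2)
    (hsp : W.HasSplitMultiplicativeReductionAtPrime p) (hκ : κ.IsCyclotomic) (hγ : κ.IsTopGenerator γ)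
    (hγ' : IsCyclotomicVariable p γ) {N : ℕ} [NeZero N] {f : CuspForm (Gamma0 N) 2} (hf : IsNewformOf W f)
    {M : ℕ} (hNM : N = p * M) (hpM : ¬ p ∣ M) (hLf : IsSplitMultPAdicLFunctionOf f p L) (hL : L ≠ 0)
    (D : W.SelmerDualData κ γ) :
    D.IsTorsion ∧
      ∃ (m : ℕ) (g : IwasawaAlgebra p), g ∈ D.charIdeal ∧
        iwasawaToPowerSeries p (PowerSeries.X * g) = PowerSeries.C ((p : ℚ_[p]) ^ m) * L := by
  refine multSplitBody_of_contra hf hsp hNM hpM hLf hκ hγ D (fun D' hfin ↦ ?_)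
  haveI := hfin
  obtain ⟨I⟩ := hne W p κ γ hκ hγ
  obtain ⟨K, hK⟩ := hin W p f κ γ hp hsp hκ hγ hγ' hf L hLf I D'
  exact katoDivisibility_splitMult_contra_of_inputs h12 hκ hγ K hK hL hLf.constantCoeff_eq_zero

/-- **VII′ NON-SPLIT at the conductor level** (`f` of level `N_W`; no level hypothesis — `f_p = 1` at a multiplicative prime).
[cite: Kato2004Asterisque, Thm. 17.4 (1)(2) (p. 273; shape) and §17.13 (pp. 279–280)] [cite: MazurTateTeitelbaum1986Invent, §I.17] -/
theorem katoDivisibility_nonsplitMult_of_contra_facts_conductorLevel [W.IsGloballyMinimal]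
    [NeZero (W.conductorNorm ℤ)]
    (hne : nonempty_iwasawaH1Data) (h12 : thm12_4) (hin : exists_multDivisibilityInputs_nonsplit_contra)
    (hp : p ≠ 2) (hmult : W.HasMultiplicativeReductionAtPrime p)
    (hns : ¬ W.HasSplitMultiplicativeReductionAtPrime p) (hκ : κ.IsCyclotomic) (hγ : κ.IsTopGenerator γ)
    (hγ' : IsCyclotomicVariable p γ) {f : CuspForm (Gamma0 (W.conductorNorm ℤ)) 2} (hf : IsNewformOf W f)
    (hLf : IsMultPAdicLFunctionOf f p (-1) L) (hL : L ≠ 0) (D : W.SelmerDualData κ γ) :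
    D.IsTorsion ∧
      ∃ (m : ℕ) (g : IwasawaAlgebra p), g ∈ D.charIdeal ∧
        iwasawaToPowerSeries p g = PowerSeries.C ((p : ℚ_[p]) ^ m) * L := by
  obtain ⟨hNM, hpM⟩ := conductorNorm_eq_mul_div_and_not_dvd (W := W) hmult
  exact katoDivisibility_nonsplitMult_of_contra_facts hne h12 hin hp hmult hns hκ hγ hγ' hf hNM hpM hLf hL D

/-- **VII′ SPLIT at the conductor level** (`f` of level `N_W`; no level hypothesis).
[cite: Kato2004Asterisque, §17.13 (pp. 279–280)] [cite: Wuthrich2014, Cor. 19 (p. 398; shape, odd p)]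
[cite: MazurTateTeitelbaum1986Invent, §I.17] -/
theorem katoDivisibility_splitMult_of_contra_facts_conductorLevel [W.IsGloballyMinimal]
    [NeZero (W.conductorNorm ℤ)]
    (hne : nonempty_iwasawaH1Data) (h12 : thm12_4) (hin : exists_multDivisibilityInputs_split_contra)
    (hp : p ≠ 2) (hsp : W.HasSplitMultiplicativeReductionAtPrime p) (hκ : κ.IsCyclotomic)
    (hγ : κ.IsTopGenerator γ) (hγ' : IsCyclotomicVariable p γ) {f : CuspForm (Gamma0 (W.conductorNorm ℤ)) 2}
    (hf : IsNewformOf W f) (hLf : IsSplitMultPAdicLFunctionOf f p L) (hL : L ≠ 0) (D : W.SelmerDualData κ γ) :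
    D.IsTorsion ∧
      ∃ (m : ℕ) (g : IwasawaAlgebra p), g ∈ D.charIdeal ∧
        iwasawaToPowerSeries p (PowerSeries.X * g) = PowerSeries.C ((p : ℚ_[p]) ^ m) * L := by
  obtain ⟨hNM, hpM⟩ := conductorNorm_eq_mul_div_and_not_dvd (W := W) hsp.hasMultiplicativeReductionAtPrime
  exact katoDivisibility_splitMult_of_contra_facts hne h12 hin hp hsp hκ hγ hγ' hf hNM hpM hLf hL D

end Mult

end SelmerDualContra

end Summit.BirchSwinnertonDyer.BirchSwinnertonDyer.Theorems

end
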